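import Summits.AtomisticToContinuum.HydrodynamicLimit.Theses.LambertianContactSwap
import Summits.AtomisticToContinuum.HydrodynamicLimit.Theses.LindebergRandomFuture
import Summits.AtomisticToContinuum.HydrodynamicLimit.Theorems.LambertianContactSwapMergingTransfer
import Summits.AtomisticToContinuum.HydrodynamicLimit.Theorems.LambertianContactSwapLocalGibbsProbability
import HarnessLib

/-!
# `Assembly` (stmt-AtomisticToContinuum-11856): the dock of route `LambertianContactSwap`

Route `LambertianContactSwap` of the sub-problem `HydrodynamicLimit` decides the conjunct through
`closes hS hL hA := hA hS hL`; this file proves the assembly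
`Assembly : SwapGap → LambertianEuler → HydrodynamicLimit`.

Mathematics: the Markov/Portmanteau transfer (Billingsley 1999, Thm. 2.1; Dudley 2002, §11.3)
is the in-tree theorem
`mergingTransfer_proof : LocalGibbsProbability → SwapGap → LambertianEuler → HydrodynamicLimit`
(`σ₀ :=` the minimum of the three thresholds; Markov with the `1`-Lipschitz cutoff
`g_δ(x) = min 1 (max (x - δ/2) 0)`, `SwapGap` for the test function `g_δ ∘ |· - c| ∘ proj`,
`g_δ ≤ 𝟙_{(δ/2,∞)}`, `LambertianEuler` at `δ/2`, field by field), and its first antecedent —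
the local Gibbs laws are probability measures for `σ < 1/2` — is the in-tree theorem
`localGibbsProbability_proof`. The assembly is their composition.

D-0032 (2026-08-16T21:23Z): the conjunct `_root_.HydrodynamicLimit` was re-typed to the packing-guarded
form (`∃ η₀, …`, `Summits/AtomisticToContinuum/HydrodynamicLimit/Statement.lean`); `mergingTransfer_proof`
concludes the UNGUARDED Literature conjecture `Literature.MathematicalPhysics.KineticTheory.HydrodynamicLimit`,
so both proofs below now end with `HydrodynamicLimit.of_unguarded` (statements unchanged; repair by the
crux lead prover-line-stmt-AtomisticToContinuum-11850-c6-0 so that the module rebuilds).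

The item is shared by signature with route `LindebergRandomFuture`, whose `SwapGap`,
`LambertianEuler` and `Assembly` are syntactically the same terms (definitionally equal to the
`LambertianContactSwap` ones); the second theorem records that route's decl by name.
-/

namespace Summit.AtomisticToContinuum.HydrodynamicLimit.Theorems

open Summit.AtomisticToContinuum.HydrodynamicLimit.Theses

/-- **The dock of route LambertianContactSwap** (assembly item `Assembly`): if the field laws of
the deterministic hard-sphere flow `Φ_t` and of the Lambertian flow `Λ_t` merge in
bounded-Lipschitz distance (`SwapGap`) and `Λ`'s χ-tested empirical fields converge in
probability to the Euler values (`LambertianEuler`), then the sub-problem statement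
`HydrodynamicLimit` holds. Composition of the typed Portmanteau/Markov transfer
`mergingTransfer_proof` with the proved probability-measure lemma `localGibbsProbability_proof`.
[cite: Dudley2002, §11.3] -/
theorem lambertianContactSwap_assembly_proof : LambertianContactSwap.Assembly := by
  unfold LambertianContactSwap.Assembly
  intro hS hL
  -- D-0032 (2026-08-16): the conjunct `_root_.HydrodynamicLimit` is now packing-guarded (`∃ η₀, …`);
  -- the merging transfer proves the UNGUARDED Literature conjecture, which implies it.
  exact _root_.HydrodynamicLimit.of_unguarded (mergingTransfer_proof localGibbsProbability_proof hS hL)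

/-- **The same dock, stated for route LindebergRandomFuture** (the shared assembly item; its
`SwapGap` and `LambertianEuler` are definitionally the `LambertianContactSwap` ones):
`SwapGap → LambertianEuler → HydrodynamicLimit`. [cite: Dudley2002, §11.3] -/
theorem lindebergRandomFuture_assembly_proof : LindebergRandomFuture.Assembly := by
  unfold LindebergRandomFuture.Assembly
  intro hS hL
  exact _root_.HydrodynamicLimit.of_unguarded (mergingTransfer_proof localGibbsProbability_proof hS hL)

end Summit.AtomisticToContinuum.HydrodynamicLimit.Theorems
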